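import Mathlib.GroupTheory.GroupAction.Quotient
import Mathlib.GroupTheory.FreeGroup.Reduce
import Mathlib.Data.List.Infix
import Literature.AnabelianGeometry.SemiGraphs.Rose
import HarnessLib

/-!
# The finite core of a Schreier coset graph ([SemiAnbd] §1, Cor. 1.6 (i))

Mochizuki, *Semi-graphs of anabelioids*, Publ. RIMS **42** (2006), Cor. 1.6 (i) (A. Tamagawa):
for a finitely generated subgroup `F` of a free group `G` there is an immersion of finite graphs
`G_A → G_B` realising `F ↪ G` on fundamental groups.  The classical construction (Stallings,
*Topology of finite graphs*, Invent. Math. 71 (1983), §5–§7; Serre, *Trees*, I.3): `G_B` is the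
bouquet on a free basis `(x_i)_{i∈ι}` of `Γ = G` (`Rose.lean`) and `G_A` is a finite connected
sub-graph, containing the base point, of the SCHREIER COSET GRAPH of `H = ⟨S⟩ ≤ Γ` (vertices
`Γ/H`, an edge `c → x_i · c` for every coset `c` and `i`) large enough to contain the closed
paths spelled by the generators `S`.  Concretely (as in Lyndon–Schupp I.3.10 / the cell's
`FreeFactorCompletion.lean`) we take the cosets `w · x₀` for the suffixes `w` of the reduced words
of the elements of `S`, and ALL coset-graph edges among them:

* `SchreierCore.Vset bΓ S`, the finite set of these cosets; `coreGraph bΓ S`, the resulting finite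
  graph (edges `(c, i)` with `c`, `x_i c` both in `Vset`; source branch `(e, false)`, target branch
  `(e, true)`), and the morphism `coreToRose bΓ S` to the bouquet forgetting the cosets;
* `coreToRose_isImmersion`: it is an immersion (the coset graph is a covering of the bouquet:
  `Γ` acts on `Γ/H` by bijections);
* `pathLabel_smul_x₀`: the label of (the image of) a zigzag path from the base vertex carries `x₀`
  to the endpoint; hence closed paths have labels in `H` (`pathLabel_mem`);
* `exists_closed_path` : every generator `g ∈ S` is the label of a closed path at the base vertex.

With `Rose.lean` and `FundamentalGroupImmersions.lean` this yields Cor. 1.6 (i)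
(`FundamentalGroupProofs.lean`).  Classical; no new mathematics.
-/

namespace Literature.AnabelianGeometry.SemiGraphs

namespace SemiGraph

open CategoryTheory Quiver
open Literature.GroupTheory.CombinatorialGroupTheory
open Literature.GroupTheory.CombinatorialGroupTheory.FreeGroupoidWords

open scoped Classical

universe u

variable {ι Γ : Type u} [Group Γ] (bΓ : FreeGroupBasis ι Γ) (S : Finset Γ)

namespace SchreierCore

/-! ### Words in the basis, the coset space and the finite vertex set -/

/-- `H = ⟨S⟩`. [cite: MochizukiSemiAnbd2006, Cor. 1.6(i) p.19] -/
abbrev Hgen : Subgroup Γ := Subgroup.closure (S : Set Γ)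

/-- The coset space `Γ/H`. [cite: MochizukiSemiAnbd2006, Cor. 1.6(i) p.19] -/
abbrev Q : Type u := Γ ⧸ Hgen S

/-- The base point `x₀ = H` of `Γ/H`. [cite: MochizukiSemiAnbd2006, Cor. 1.6(i) p.19] -/
def x₀ : Q S := ((1 : Γ) : Q S)

omit [Group Γ] in
/-- The stabiliser of the base point is `H`. [cite: MochizukiSemiAnbd2006, Cor. 1.6(i) p.19] -/
theorem smul_x₀_eq_iff [Group Γ] (S : Finset Γ) (g : Γ) : g • x₀ S = x₀ S ↔ g ∈ Hgen S := by
  rw [← MulAction.mem_stabilizer_iff, x₀, MulAction.stabilizer_quotient]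

/-- The element of `Γ` spelled by a word in the basis `bΓ` and its inverses.
[cite: MochizukiSemiAnbd2006, Cor. 1.6(i) p.19] -/
noncomputable def wordProd (L : List (ι × Bool)) : Γ := bΓ.repr.symm (FreeGroup.mk L)

/-- The reduced word of an element of `Γ` in the basis `bΓ`. [cite: MochizukiSemiAnbd2006, Cor. 1.6(i) p.19] -/
noncomputable def word (g : Γ) : List (ι × Bool) := (bΓ.repr g).toWord

/-- An element is the product of its reduced word. [cite: MochizukiSemiAnbd2006, Cor. 1.6(i) p.19] -/
theorem wordProd_word (g : Γ) : wordProd bΓ (word bΓ g) = g := by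
  simp [wordProd, word, FreeGroup.mk_toWord]

/-- The empty word spells `1`. [cite: MochizukiSemiAnbd2006, Cor. 1.6(i) p.19] -/
theorem wordProd_nil : wordProd bΓ ([] : List (ι × Bool)) = 1 := by
  simp [wordProd, ← FreeGroup.one_eq_mk]

/-- A positive letter in front multiplies by the basis element. [cite: MochizukiSemiAnbd2006, Cor. 1.6(i) p.19] -/
theorem wordProd_cons_true (i : ι) (L : List (ι × Bool)) :
    wordProd bΓ ((i, true) :: L) = bΓ i * wordProd bΓ L := by
  have h : FreeGroup.mk ((i, true) :: L) = FreeGroup.of i * FreeGroup.mk L := rfl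
  rw [wordProd, h, map_mul]
  rfl

/-- A negative letter in front multiplies by the inverse basis element.
[cite: MochizukiSemiAnbd2006, Cor. 1.6(i) p.19] -/
theorem wordProd_cons_false (i : ι) (L : List (ι × Bool)) :
    wordProd bΓ ((i, false) :: L) = (bΓ i)⁻¹ * wordProd bΓ L := by
  have h : FreeGroup.mk ((i, false) :: L) = (FreeGroup.of i)⁻¹ * FreeGroup.mk L := rfl
  rw [wordProd, h, map_mul, map_inv]
  rfl

/-- The finite set of cosets visited while reading the reduced words of the generators from the
right, together with the base point. [cite: MochizukiSemiAnbd2006, Cor. 1.6(i) p.19] -/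
def Vset : Set (Q S) :=
  insert (x₀ S) (⋃ g ∈ (S : Set Γ), (fun L => wordProd bΓ L • x₀ S) '' {L | L <:+ word bΓ g})

/-- `Vset` is finite. [cite: MochizukiSemiAnbd2006, Cor. 1.6(i) p.19] -/
theorem vset_finite : (Vset bΓ S).Finite := by
  refine Set.Finite.insert _ (Set.Finite.biUnion S.finite_toSet fun g _ => Set.Finite.image _ ?_)
  exact (List.finite_toSet (word bΓ g).tails).subset fun L hL => (List.mem_tails L _).mpr hL

/-- The base point is a vertex. [cite: MochizukiSemiAnbd2006, Cor. 1.6(i) p.19] -/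
theorem x₀_mem : x₀ S ∈ Vset bΓ S := Set.mem_insert _ _

/-- The coset of a suffix of the word of a generator is a vertex. [cite: MochizukiSemiAnbd2006, Cor. 1.6(i) p.19] -/
theorem suffix_mem {g : Γ} (hg : g ∈ S) {L : List (ι × Bool)} (hL : L <:+ word bΓ g) :
    wordProd bΓ L • x₀ S ∈ Vset bΓ S :=
  Set.mem_insert_of_mem _ (Set.mem_biUnion (Finset.mem_coe.mpr hg) ⟨L, hL, rfl⟩)

/-- The type of vertices of the core graph. [cite: MochizukiSemiAnbd2006, Cor. 1.6(i) p.19] -/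
abbrev V : Type u := ↥(Vset bΓ S)

/-- The base vertex. [cite: MochizukiSemiAnbd2006, Cor. 1.6(i) p.19] -/
def v₀ : V bΓ S := ⟨x₀ S, x₀_mem bΓ S⟩

/-- The type of edges of the core graph: coset-graph edges `c → x_i · c` with both ends vertices.
[cite: MochizukiSemiAnbd2006, Cor. 1.6(i) p.19] -/
abbrev E : Type u := {p : V bΓ S × ι // (bΓ p.2 : Γ) • (p.1 : Q S) ∈ Vset bΓ S}

variable {bΓ S}

/-- The source vertex of an edge. [cite: MochizukiSemiAnbd2006, Cor. 1.6(i) p.19] -/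
def src (e : E bΓ S) : V bΓ S := e.1.1

/-- The letter (loop of the bouquet) over which an edge lies. [cite: MochizukiSemiAnbd2006, Cor. 1.6(i) p.19] -/
def lbl (e : E bΓ S) : ι := e.1.2

/-- The target vertex `x_i · c` of an edge. [cite: MochizukiSemiAnbd2006, Cor. 1.6(i) p.19] -/
def tgt (e : E bΓ S) : V bΓ S := ⟨(bΓ e.1.2 : Γ) • (e.1.1 : Q S), e.2⟩

/-- The coset of the target is `x_i` times the coset of the source.
[cite: MochizukiSemiAnbd2006, Cor. 1.6(i) p.19] -/
theorem coe_tgt (e : E bΓ S) : (tgt e : Q S) = (bΓ (lbl e) : Γ) • (src e : Q S) := rfl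

end SchreierCore

open SchreierCore

/-- **The core graph** `G_A`: vertices `Vset`, edges the coset-graph edges among them, each edge
with a source branch `(e, false)` and a target branch `(e, true)`.
[cite: MochizukiSemiAnbd2006, Cor. 1.6(i) p.19] -/
noncomputable def coreGraph : SemiGraph.{u} where
  Vertex := V bΓ S
  Edge := E bΓ S
  Branch := E bΓ S × Bool
  edgeOf := Prod.fst
  abuts b := some (cond b.2 (tgt b.1) (src b.1))
  two_branches e := ⟨(e, false), (e, true), by simp, rfl, rfl, fun b hb => by
    obtain ⟨e', s⟩ := b
    cases hb
    cases s
    · exact Or.inl rfl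
    · exact Or.inr rfl⟩

/-- The core graph is a graph. [cite: MochizukiSemiAnbd2006, Cor. 1.6(i) p.19] -/
theorem coreGraph_isGraph : (coreGraph bΓ S).IsGraph := ⟨fun _ => rfl⟩

/-- The core graph is finite (for a finite basis). [cite: MochizukiSemiAnbd2006, Cor. 1.6(i) p.19] -/
theorem coreGraph_isFinite [Finite ι] : (coreGraph bΓ S).IsFinite := by
  haveI : Finite (V bΓ S) := (vset_finite bΓ S).to_subtype
  exact ⟨‹Finite (V bΓ S)›, inferInstanceAs (Finite (E bΓ S))⟩

/-- **The morphism to the bouquet** forgetting the cosets: an edge over the letter `i` goes to the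
loop `i`, source branch to source branch, target branch to target branch.
[cite: MochizukiSemiAnbd2006, Cor. 1.6(i) p.19] -/
noncomputable def coreToRose : coreGraph bΓ S ⟶ rose ι where
  vertexMap _ := Rose.vtx ι
  edgeMap := lbl
  branchMap b := (lbl b.1, b.2)
  edgeOf_branchMap _ := rfl
  branchMap_injOn b₁ b₂ he h := by
    obtain ⟨e₁, s₁⟩ := b₁
    obtain ⟨e₂, s₂⟩ := b₂
    cases he
    cases congrArg Prod.snd h
    rfl
  abuts_branchMap _ _ _ := rfl

/-- **The morphism to the bouquet is an immersion**: at a vertex `c`, two branches over the same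
branch `(i, s)` of the bouquet are equal, because `x_i ·` is a bijection of `Γ/H`.
[cite: MochizukiSemiAnbd2006, Cor. 1.6(i) p.19] -/
theorem coreToRose_isImmersion : IsImmersion (coreToRose bΓ S) := by
  intro c b₁ b₂ h
  obtain ⟨⟨e₁, s₁⟩, h₁⟩ := b₁
  obtain ⟨⟨e₂, s₂⟩, h₂⟩ := b₂
  have h' := congrArg Subtype.val h
  change ((lbl e₁, s₁) : ι × Bool) = (lbl e₂, s₂) at h'
  obtain ⟨hl, hs⟩ := Prod.mk.inj h'
  subst hs
  suffices he : e₁ = e₂ by subst he; rfl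
  apply Subtype.ext
  cases s₁
  · -- source branches: same source vertex and same letter
    have ha₁ : src e₁ = c := Option.some.inj h₁
    have ha₂ : src e₂ = c := Option.some.inj h₂
    exact Prod.ext (ha₁.trans ha₂.symm) hl
  · -- target branches: `x_i · c₁ = x_i · c₂` forces `c₁ = c₂`
    have ha₁ : tgt e₁ = c := Option.some.inj h₁
    have ha₂ : tgt e₂ = c := Option.some.inj h₂
    refine Prod.ext (Subtype.ext ?_) hl
    have ht : (tgt e₁ : Q S) = (tgt e₂ : Q S) := by rw [ha₁, ha₂]
    rw [coe_tgt, coe_tgt, hl] at ht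
    exact smul_left_cancel _ ht

namespace SchreierCore

variable {bΓ S}

/-! ### Arrows of `Cat(G_A)` and labels of their images -/

/-- The arrow `e → c` of `Cat(G_A)` given by the branch `(e, s)`, for any vertex `c` it abuts to
(stated with a proof parameter so that both syntactic forms of the target can be used).
[cite: MochizukiSemiAnbd2006, Def. 2.11 p.32] -/
def brArrow (e : E bΓ S) (s : Bool) (c : V bΓ S) (h : cond s (tgt e) (src e) = c) :
    @Quiver.Hom (coreGraph bΓ S).CatCarrier _ (Sum.inr e) (Sum.inl c) :=
  ⟨(e, s), rfl, congrArg some h⟩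

/-- The label of the image of a forward branch arrow. [cite: MochizukiSemiAnbd2006, Cor. 1.6(i) p.19] -/
theorem arrowLabel_map_inl (e : E bΓ S) (s : Bool) (c : V bΓ S) (h : cond s (tgt e) (src e) = c) :
    Rose.arrowLabel bΓ ((Hom.catPrefunctor (coreToRose bΓ S)).symmetrify.map
      (Sum.inl (brArrow e s c h) :
        (Quiver.symmetrifyQuiver (coreGraph bΓ S).CatCarrier).Hom (Sum.inr e) (Sum.inl c))) =
      cond s (bΓ (lbl e)) 1 := rfl

/-- The label of the image of a backward branch arrow. [cite: MochizukiSemiAnbd2006, Cor. 1.6(i) p.19] -/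
theorem arrowLabel_map_inr (e : E bΓ S) (s : Bool) (c : V bΓ S) (h : cond s (tgt e) (src e) = c) :
    Rose.arrowLabel bΓ ((Hom.catPrefunctor (coreToRose bΓ S)).symmetrify.map
      (Sum.inr (brArrow e s c h) :
        (Quiver.symmetrifyQuiver (coreGraph bΓ S).CatCarrier).Hom (Sum.inl c) (Sum.inr e))) =
      (cond s (bΓ (lbl e)) 1)⁻¹ := rfl

/-- Every arrow `e → c` of `Cat(G_A)` is a branch arrow. [cite: MochizukiSemiAnbd2006, Def. 2.11 p.32] -/
theorem arrow_eq (e : E bΓ S) (c : V bΓ S)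
    (x : @Quiver.Hom (coreGraph bΓ S).CatCarrier _ (Sum.inr e) (Sum.inl c)) :
    ∃ (s : Bool) (h : cond s (tgt e) (src e) = c), x = brArrow e s c h := by
  obtain ⟨⟨e', s⟩, h₁, h₂⟩ := x
  change e' = e at h₁
  subst h₁
  exact ⟨s, Option.some.inj h₂, rfl⟩

/-! ### The label of a path moves the base point to the endpoint -/

/-- The coset attached to an object of `Cat(G_A)`: a vertex's coset, an edge's source coset.
[cite: MochizukiSemiAnbd2006, Cor. 1.6(i) p.19] -/
def pos : (coreGraph bΓ S).CatCarrier → Q S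
  | Sum.inl c => Subtype.val c
  | Sum.inr e => (src e : Q S)

/-- The base vertex as an object of the symmetrised quiver. [cite: MochizukiSemiAnbd2006, Cor. 1.6(i) p.19] -/
abbrev vObj (c : V bΓ S) : Symmetrify (coreGraph bΓ S).CatCarrier := Sum.inl c

/-- One step: the label of (the image of) a formal arrow carries the coset of its source object to
the coset of its target object. [cite: MochizukiSemiAnbd2006, Cor. 1.6(i) p.19] -/
theorem arrowLabel_smul_pos {Y Z : Symmetrify (coreGraph bΓ S).CatCarrier} (f : Y ⟶ Z) :
    Rose.arrowLabel bΓ ((Hom.catPrefunctor (coreToRose bΓ S)).symmetrify.map f) • pos Y =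
      pos Z := by
  rcases f with x | x
  · rcases Y with c | e <;> rcases Z with c' | e'
    · exact PEmpty.elim x
    · exact PEmpty.elim x
    · obtain ⟨s, h, rfl⟩ := arrow_eq e c' x
      rw [arrowLabel_map_inl]
      change (cond s (bΓ (lbl e)) 1 : Γ) • (src e : Q S) = Subtype.val c'
      rw [← h]
      cases s
      · exact one_smul _ _
      · rfl
    · exact PEmpty.elim x
  · rcases Y with c | e <;> rcases Z with c' | e'
    · exact PEmpty.elim x
    · obtain ⟨s, h, rfl⟩ := arrow_eq e' c x
      rw [arrowLabel_map_inr]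
      change (cond s (bΓ (lbl e')) 1 : Γ)⁻¹ • Subtype.val c = (src e' : Q S)
      rw [← h]
      cases s
      · exact (congrArg (· • _) inv_one).trans (one_smul _ _)
      · exact inv_smul_smul _ _
    · exact PEmpty.elim x
    · exact PEmpty.elim x

/-- **The label of a zigzag path from the base vertex carries `x₀` to the endpoint.**
[cite: MochizukiSemiAnbd2006, Cor. 1.6(i) p.19] -/
theorem pathLabel_smul_x₀ :
    ∀ {Y : Symmetrify (coreGraph bΓ S).CatCarrier} (p : Path (vObj (v₀ bΓ S)) Y),
      Rose.pathLabel bΓ ((Hom.catPrefunctor (coreToRose bΓ S)).symmetrify.mapPath p) • x₀ S =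
        pos Y
  | _, Path.nil => by rw [Prefunctor.mapPath_nil, Rose.pathLabel_nil, one_smul]; rfl
  | _, Path.cons p f => by
    rw [Prefunctor.mapPath_cons, Rose.pathLabel_cons, mul_smul, pathLabel_smul_x₀ p,
      arrowLabel_smul_pos]

variable (bΓ S) in
/-- **Closed paths have labels in `H`.** [cite: MochizukiSemiAnbd2006, Cor. 1.6(i) p.19] -/
theorem pathLabel_mem (p : Path (vObj (v₀ bΓ S)) (vObj (v₀ bΓ S))) :
    Rose.pathLabel bΓ ((Hom.catPrefunctor (coreToRose bΓ S)).symmetrify.mapPath p) ∈ Hgen S := by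
  rw [← smul_x₀_eq_iff]
  exact pathLabel_smul_x₀ p

/-! ### The closed paths spelled by the generators -/

/-- Every suffix of the word of a generator spells a path in `G_A` from the base vertex to the coset
of the suffix, with that label. [cite: MochizukiSemiAnbd2006, Cor. 1.6(i) p.19] -/
theorem exists_path_of_suffix {g : Γ} (hg : g ∈ S) :
    ∀ (L : List (ι × Bool)), L <:+ word bΓ g →
      ∃ (c : V bΓ S) (p : Path (vObj (v₀ bΓ S)) (vObj c)),
        (c : Q S) = wordProd bΓ L • x₀ S ∧
        Rose.pathLabel bΓ ((Hom.catPrefunctor (coreToRose bΓ S)).symmetrify.mapPath p) =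
          wordProd bΓ L
  | [], _ => ⟨v₀ bΓ S, Path.nil, by rw [wordProd_nil, one_smul]; rfl, by
      rw [Prefunctor.mapPath_nil, Rose.pathLabel_nil, wordProd_nil]⟩
  | (i, true) :: L, hL => by
    obtain ⟨c, p, hc, hl⟩ := exists_path_of_suffix hg L ((List.suffix_cons _ L).trans hL)
    -- the edge `e = (c, i)`: its target `x_i · c` is the coset of the longer suffix
    have hmem : (bΓ i : Γ) • (c : Q S) ∈ Vset bΓ S := by
      rw [hc, ← mul_smul, ← wordProd_cons_true]
      exact suffix_mem bΓ S hg hL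
    let e : E bΓ S := ⟨(c, i), hmem⟩
    refine ⟨tgt e, (p.cons (Sum.inr (brArrow e false c rfl))).cons (Sum.inl (brArrow e true (tgt e) rfl)),
      ?_, ?_⟩
    · rw [coe_tgt, wordProd_cons_true, mul_smul, ← hc]; rfl
    · rw [Prefunctor.mapPath_cons, Prefunctor.mapPath_cons, Rose.pathLabel_cons,
        Rose.pathLabel_cons, arrowLabel_map_inl, arrowLabel_map_inr, hl, wordProd_cons_true]
      simp [lbl, e]
  | (i, false) :: L, hL => by
    obtain ⟨c, p, hc, hl⟩ := exists_path_of_suffix hg L ((List.suffix_cons _ L).trans hL)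
    -- the edge `e = (x_i⁻¹ · c, i)`, traversed backwards: its target is `c`
    have hmem : (bΓ i : Γ)⁻¹ • (c : Q S) ∈ Vset bΓ S := by
      rw [hc, ← mul_smul, ← wordProd_cons_false]
      exact suffix_mem bΓ S hg hL
    let c' : V bΓ S := ⟨(bΓ i : Γ)⁻¹ • (c : Q S), hmem⟩
    have hmem' : (bΓ i : Γ) • (c' : Q S) ∈ Vset bΓ S := by
      change (bΓ i : Γ) • ((bΓ i : Γ)⁻¹ • (c : Q S)) ∈ Vset bΓ S
      rw [smul_inv_smul]
      exact c.2
    let e : E bΓ S := ⟨(c', i), hmem'⟩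
    have htgt : tgt e = c := Subtype.ext (smul_inv_smul (bΓ i : Γ) (c : Q S))
    refine ⟨c', (p.cons (Sum.inr (brArrow e true c htgt))).cons (Sum.inl (brArrow e false c' rfl)),
      ?_, ?_⟩
    · rw [wordProd_cons_false, mul_smul, ← hc]
    · rw [Prefunctor.mapPath_cons, Prefunctor.mapPath_cons, Rose.pathLabel_cons,
        Rose.pathLabel_cons, arrowLabel_map_inl, arrowLabel_map_inr, hl, wordProd_cons_false]
      simp [lbl, e]

variable (bΓ S) in
/-- **Every generator is the label of a closed path of `G_A` at the base vertex.**
[cite: MochizukiSemiAnbd2006, Cor. 1.6(i) p.19] -/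
theorem exists_closed_path {g : Γ} (hg : g ∈ S) :
    ∃ p : Path (vObj (v₀ bΓ S)) (vObj (v₀ bΓ S)),
      Rose.pathLabel bΓ ((Hom.catPrefunctor (coreToRose bΓ S)).symmetrify.mapPath p) = g := by
  obtain ⟨c, p, hc, hl⟩ := exists_path_of_suffix hg (word bΓ g) (List.suffix_refl _)
  rw [wordProd_word] at hc hl
  have hg' : g • x₀ S = x₀ S := (smul_x₀_eq_iff S g).mpr (Subgroup.subset_closure hg)
  have hcv : c = v₀ bΓ S := Subtype.ext (hc.trans hg')
  subst hcv
  exact ⟨p, hl⟩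

end SchreierCore

end SemiGraph

end Literature.AnabelianGeometry.SemiGraphs
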